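import Summits.QuantumFields.QCD.Theorems.SmallFieldUltracontractivity.Negative.Tightness
import Summits.QuantumFields.QCD.Theorems.HeatSlicedQuarksFreeKernelPowerCountingFourier
import Literature.Probability.LatticeModels.TorusFourierProofs

/-!
# Stub `stub_freeKernelFourier` of line `point-centred-axial-parabolic`
(crux `Summit.QuantumFields.QCD.Theses.HeatSlicedQuarks.SmallFieldUltracontractivity`, item stmt-QuantumFields-8871)

The exact torus-Fourier representation of the FREE MASSIVE Wilson heat kernel.  For the free
(`U ≡ 1`, the tree's `freeCfg L`), `r = 1` Wilson–Dirac operator `D_m = wilsonDirac ρ 1 m 1` of bare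
mass `m` on the four-torus `(ℤ/L)⁴` with colour `Fin 3` and spin `Fin 4`, the positive operator
`H_m = D_mᴴ D_m` is diagonalised by the unitary plane-wave matrix `P = F ⊗ 1`,
`F(x,k) = L⁻² χ_k(x)`, of `HeatSlicedQuarksFreeKernelPowerCountingFourier`:
since `D_m = m·1 + D₀` (`wilsonDirac_eq_sub_sum_wilsonHop` at `m` and at `0`),
`D_m P = Q_m` carries the colour–spin symbol `M_m(k) = (m + W(k))·1 + iΣ_μ sin θ_μ γ_μ`,
`W(k) = Σ_μ (1 − cos θ_μ)`, `θ_μ = 2π k_μ.val / L`, and the Clifford identity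
(`clifford_conjTranspose_mul_self` with the real coefficient `m + W(k)`) squares it to the scalar
`h_m(k) = (m + W(k))² + Σ_μ sin² θ_μ`: `Q_mᴴ Q_m = diagonal (h_m)`.  Hence
`exp(−σ H_m) = P · diagonal(e^{−σ h_m}) · Pᴴ` (`exp_neg_smul_conjTranspose_mul_self_apply`) and
`exp(−σ H_m)((x,a,α),(z,b,β)) = δ_{(a,α),(b,β)} · L⁻⁴ Σ_k e^{−σ h_m(k)} χ_k(x) conj χ_k(z)`
(`stub_freeKernelFourier`; the `m = 0` case is the tree's `exp_freeWilson_apply`).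

References: Montvay–Münster, *Quantum Fields on a Lattice* §4.2 (free Wilson fermions in momentum
space); the diagonalisation is folklore.  Pure theorem file (no definitions).
-/

noncomputable section

namespace Summit.QuantumFields.QCD.Cruxes.SmallFieldUltracontractivity.PointCentredAxialParabolic

open Literature.MathematicalPhysics.QuantumLattice Literature.MathematicalPhysics.QuantumFieldTheory
open Literature.Probability.LatticeModels (TorusSite torusChar)
open Summit.QuantumFields.QCD.Theorems.SmallFieldUltracontractivity.Negative
open scoped Matrix ComplexConjugate

open Summit.QuantumFields.QCD.Theorems.HeatSlicedQuarks.FreeKernel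
open Summit.QuantumFields.QCD.Cruxes.TipNoBinding.PositivityNoLeakSpread
open Matrix (diagonal)
open Complex (I)
open scoped Kronecker Real

section MassivePlaneWaves

variable {L : ℕ} [NeZero L]

omit [NeZero L] in
/-- **Mass shift**: the free `r = 1` Wilson–Dirac operator at bare mass `m` is the massless one plus
`m · 1` (both sides are `(m + 4)·1 − Σ_μ W_μ`, `wilsonDirac_eq_sub_sum_wilsonHop`). -/
theorem wilsonDirac_one_mass_eq_smul_one_add (m : ℝ) :
    wilsonDirac (fundamentalRep (Fin 3)) (1 : GaugeConfig 4 L (Matrix.specialUnitaryGroup (Fin 3) ℂ)) m 1 =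
      ((m : ℝ) : ℂ) • (1 : Matrix (TorusSite 4 L × Fin 3 × Fin 4) (TorusSite 4 L × Fin 3 × Fin 4) ℂ) +
        wilsonDirac (fundamentalRep (Fin 3)) (1 : GaugeConfig 4 L (Matrix.specialUnitaryGroup (Fin 3) ℂ)) 0 1 := by
  rw [wilsonDirac_eq_sub_sum_wilsonHop (fundamentalRep (Fin 3)) fundamentalRep_mem_unitaryGroup _ m,
    wilsonDirac_eq_sub_sum_wilsonHop (fundamentalRep (Fin 3)) fundamentalRep_mem_unitaryGroup _ 0,
    ← add_sub_assoc, ← add_smul, ← Complex.ofReal_add, zero_add]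

/-- The identity on colour × spin factorises entrywise: `1_{(a,α),(b,β)} = 1_{ab} · 1_{αβ}`. -/
theorem one_colourSpin_apply (s s' : Fin 3 × Fin 4) :
    (1 : Matrix (Fin 3 × Fin 4) (Fin 3 × Fin 4) ℂ) s s' =
      (1 : Matrix (Fin 3) (Fin 3) ℂ) s.1 s'.1 * (1 : Matrix (Fin 4) (Fin 4) ℂ) s.2 s'.2 := by
  have h := congrFun (congrFun (Matrix.one_kronecker_one :
    (1 : Matrix (Fin 3) (Fin 3) ℂ) ⊗ₖ (1 : Matrix (Fin 4) (Fin 4) ℂ) = 1) s) s'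
  rw [← h, Matrix.kroneckerMap_apply]

/-- **The massive free operator on plane waves, `D_m P = Q_m`**: on the plane-wave matrix
`P = F ⊗ 1`, `F(x,k) = L⁻² χ_k(x)`, the free operator of bare mass `m` acts by the colour–spin symbol
`1 ⊗ M_m(k)`, `M_m(k) = (m + W(k))·1 + i Σ_μ sin θ_μ γ_μ`, `W(k) = Σ_μ (1 − cos θ_μ)`,
`θ_μ = 2π k_μ.val / L` (the massless `wilsonDirac_one_mul_planeP` plus the mass shift `m • P`). -/
theorem wilsonDirac_one_mass_mul_planeP (m : ℝ) :
    wilsonDirac (fundamentalRep (Fin 3)) (1 : GaugeConfig 4 L (Matrix.specialUnitaryGroup (Fin 3) ℂ)) m 1 *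
        ((Matrix.of fun x k : TorusSite 4 L => ((L : ℂ) ^ 2)⁻¹ * torusChar k x) ⊗ₖ
        (1 : Matrix (Fin 3 × Fin 4) (Fin 3 × Fin 4) ℂ)) =
      (Matrix.of fun p q : TorusSite 4 L × Fin 3 × Fin 4 =>
        (Matrix.of fun x k : TorusSite 4 L => ((L : ℂ) ^ 2)⁻¹ * torusChar k x) p.1 q.1 *
          ((1 : Matrix (Fin 3) (Fin 3) ℂ) ⊗ₖ ((((m + ∑ μ : Fin 4, (1 - Real.cos (2 * π * (ZMod.val (q.1 μ) : ℝ) / L))) : ℝ) : ℂ) • (1 : Matrix (Fin 4) (Fin 4) ℂ) +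
          I • ∑ μ : Fin 4, ((Real.sin (2 * π * (ZMod.val (q.1 μ) : ℝ) / L) : ℝ) : ℂ) • euclideanGamma μ)) p.2 q.2) := by
  rw [wilsonDirac_one_mass_eq_smul_one_add, Matrix.add_mul, Matrix.smul_mul, Matrix.one_mul,
    wilsonDirac_one_mul_planeP]
  ext p q
  simp only [Matrix.add_apply, Matrix.smul_apply, Matrix.kroneckerMap_apply, Matrix.of_apply,
    one_colourSpin_apply, smul_eq_mul, Complex.ofReal_add]
  ring

/-- **`Q_mᴴ Q_m` is diagonal with the massive scalar symbol**: `(D_m P)ᴴ (D_m P) = diagonal (h_m(k))`,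
`h_m(k) = (m + W(k))² + Σ_μ sin² θ_μ` (plane-wave orthonormality `Fᴴ F = 1` in the site factor, the
Clifford identity `M_m(k)ᴴ M_m(k) = h_m(k)·1` in the spin factor). -/
theorem symQ_mass_conjTranspose_mul_self (m : ℝ) :
    (Matrix.of fun p q : TorusSite 4 L × Fin 3 × Fin 4 =>
        (Matrix.of fun x k : TorusSite 4 L => ((L : ℂ) ^ 2)⁻¹ * torusChar k x) p.1 q.1 *
          ((1 : Matrix (Fin 3) (Fin 3) ℂ) ⊗ₖ ((((m + ∑ μ : Fin 4, (1 - Real.cos (2 * π * (ZMod.val (q.1 μ) : ℝ) / L))) : ℝ) : ℂ) • (1 : Matrix (Fin 4) (Fin 4) ℂ) +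
          I • ∑ μ : Fin 4, ((Real.sin (2 * π * (ZMod.val (q.1 μ) : ℝ) / L) : ℝ) : ℂ) • euclideanGamma μ)) p.2 q.2)ᴴ *
        (Matrix.of fun p q : TorusSite 4 L × Fin 3 × Fin 4 =>
        (Matrix.of fun x k : TorusSite 4 L => ((L : ℂ) ^ 2)⁻¹ * torusChar k x) p.1 q.1 *
          ((1 : Matrix (Fin 3) (Fin 3) ℂ) ⊗ₖ ((((m + ∑ μ : Fin 4, (1 - Real.cos (2 * π * (ZMod.val (q.1 μ) : ℝ) / L))) : ℝ) : ℂ) • (1 : Matrix (Fin 4) (Fin 4) ℂ) +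
          I • ∑ μ : Fin 4, ((Real.sin (2 * π * (ZMod.val (q.1 μ) : ℝ) / L) : ℝ) : ℂ) • euclideanGamma μ)) p.2 q.2) =
      diagonal fun q : TorusSite 4 L × Fin 3 × Fin 4 =>
        ((((m + ∑ μ : Fin 4, (1 - Real.cos (2 * π * (ZMod.val (q.1 μ) : ℝ) / L))) ^ 2 +
          ∑ μ : Fin 4, Real.sin (2 * π * (ZMod.val (q.1 μ) : ℝ) / L) ^ 2) : ℝ) : ℂ) := by
  ext q q'
  obtain ⟨k, s₀⟩ := q
  obtain ⟨k', s₀'⟩ := q'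
  rw [Matrix.mul_apply, Fintype.sum_prod_type, Matrix.diagonal_apply]
  have hs : ∀ (x : TorusSite 4 L) (s : Fin 3 × Fin 4),
      (Matrix.of fun p q : TorusSite 4 L × Fin 3 × Fin 4 =>
        (Matrix.of fun x k : TorusSite 4 L => ((L : ℂ) ^ 2)⁻¹ * torusChar k x) p.1 q.1 *
          ((1 : Matrix (Fin 3) (Fin 3) ℂ) ⊗ₖ ((((m + ∑ μ : Fin 4, (1 - Real.cos (2 * π * (ZMod.val (q.1 μ) : ℝ) / L))) : ℝ) : ℂ) • (1 : Matrix (Fin 4) (Fin 4) ℂ) +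
          I • ∑ μ : Fin 4, ((Real.sin (2 * π * (ZMod.val (q.1 μ) : ℝ) / L) : ℝ) : ℂ) • euclideanGamma μ)) p.2 q.2)ᴴ (k, s₀) (x, s) *
        (Matrix.of fun p q : TorusSite 4 L × Fin 3 × Fin 4 =>
        (Matrix.of fun x k : TorusSite 4 L => ((L : ℂ) ^ 2)⁻¹ * torusChar k x) p.1 q.1 *
          ((1 : Matrix (Fin 3) (Fin 3) ℂ) ⊗ₖ ((((m + ∑ μ : Fin 4, (1 - Real.cos (2 * π * (ZMod.val (q.1 μ) : ℝ) / L))) : ℝ) : ℂ) • (1 : Matrix (Fin 4) (Fin 4) ℂ) +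
          I • ∑ μ : Fin 4, ((Real.sin (2 * π * (ZMod.val (q.1 μ) : ℝ) / L) : ℝ) : ℂ) • euclideanGamma μ)) p.2 q.2) (x, s) (k', s₀') =
        ((Matrix.of fun x k : TorusSite 4 L => ((L : ℂ) ^ 2)⁻¹ * torusChar k x)ᴴ k x *
            (Matrix.of fun x k : TorusSite 4 L => ((L : ℂ) ^ 2)⁻¹ * torusChar k x) x k') *
          ((((1 : Matrix (Fin 3) (Fin 3) ℂ) ⊗ₖ ((((m + ∑ μ : Fin 4, (1 - Real.cos (2 * π * (ZMod.val (k μ) : ℝ) / L))) : ℝ) : ℂ) • (1 : Matrix (Fin 4) (Fin 4) ℂ) +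
          I • ∑ μ : Fin 4, ((Real.sin (2 * π * (ZMod.val (k μ) : ℝ) / L) : ℝ) : ℂ) • euclideanGamma μ))ᴴ s₀ s) *
            (((1 : Matrix (Fin 3) (Fin 3) ℂ) ⊗ₖ ((((m + ∑ μ : Fin 4, (1 - Real.cos (2 * π * (ZMod.val (k' μ) : ℝ) / L))) : ℝ) : ℂ) • (1 : Matrix (Fin 4) (Fin 4) ℂ) +
          I • ∑ μ : Fin 4, ((Real.sin (2 * π * (ZMod.val (k' μ) : ℝ) / L) : ℝ) : ℂ) • euclideanGamma μ)) s s₀')) := by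
    intro x s
    simp only [Matrix.conjTranspose_apply, Matrix.of_apply, star_mul']
    ring
  simp_rw [hs]
  rw [← Finset.sum_mul_sum, ← Matrix.mul_apply, ← Matrix.mul_apply, planeF_conjTranspose_mul_self,
    Matrix.one_apply]
  by_cases hk : k = k'
  · subst hk
    rw [if_pos rfl, one_mul, Matrix.conjTranspose_kronecker, ← Matrix.mul_kronecker_mul,
      Matrix.conjTranspose_one, Matrix.one_mul, clifford_conjTranspose_mul_self, Matrix.kronecker_smul,
      Matrix.one_kronecker_one, Matrix.smul_apply, Matrix.one_apply, smul_eq_mul, mul_ite, mul_one,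
      mul_zero]
    simp only [Prod.mk.injEq, true_and]
  · rw [if_neg hk, zero_mul, if_neg (fun h => hk (Prod.mk.injEq _ _ _ _ ▸ h).1)]

end MassivePlaneWaves

/-- **The free massive Wilson heat kernel in torus Fourier variables** (all entries): for the free
background `freeCfg L` (`U ≡ 1`), bare mass `m`, `r = 1` and real `σ`,
`exp(−σ D_mᴴ D_m)((x,a,α),(z,b,β)) = δ_{(a,α),(b,β)} · L⁻⁴ Σ_k e^{−σ h_m(k)} χ_k(x) conj χ_k(z)` with
`h_m(k) = (m + Σ_μ (1 − cos θ_μ))² + Σ_μ sin² θ_μ`, `θ_μ = 2π k_μ.val / L` (unitary plane-wave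
diagonalisation `P = F ⊗ 1`, `(D_m P)ᴴ (D_m P) = diagonal (h_m)`, `Matrix.exp_conj`,
`Matrix.exp_diagonal`; the `m = 0` case is `exp_freeWilson_apply`). -/
theorem stub_freeKernelFourier :
    ∀ (L : ℕ) [NeZero L] (m σ : ℝ) (x z : TorusSite 4 L) (a b : Fin 3) (α β : Fin 4),
      (NormedSpace.exp (-(σ : ℂ) •
          ((wilsonDirac (fundamentalRep (Fin 3)) (freeCfg L) m 1)ᴴ *
            wilsonDirac (fundamentalRep (Fin 3)) (freeCfg L) m 1))) (x, a, α) (z, b, β) =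
        if (a, α) = (b, β) then
          ∑ k : TorusSite 4 L, ((L : ℂ) ^ 2)⁻¹ * ((L : ℂ) ^ 2)⁻¹ *
            (Complex.exp (-(σ : ℂ) *
              (((m + ∑ μ : Fin 4, (1 - Real.cos (2 * Real.pi * (ZMod.val (k μ) : ℝ) / L))) ^ 2 +
                  ∑ μ : Fin 4, Real.sin (2 * Real.pi * (ZMod.val (k μ) : ℝ) / L) ^ 2 : ℝ) : ℂ)) *
              (torusChar k x * conj (torusChar k z)))
        else 0 := by
  intro L _ m σ x z a b α β
  rw [show freeCfg L = (1 : GaugeConfig 4 L (Matrix.specialUnitaryGroup (Fin 3) ℂ)) from rfl]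
  set P : Matrix (TorusSite 4 L × Fin 3 × Fin 4) (TorusSite 4 L × Fin 3 × Fin 4) ℂ :=
    ((Matrix.of fun x k : TorusSite 4 L => ((L : ℂ) ^ 2)⁻¹ * torusChar k x) ⊗ₖ
        (1 : Matrix (Fin 3 × Fin 4) (Fin 3 × Fin 4) ℂ)) with hP
  have hd : (wilsonDirac (fundamentalRep (Fin 3)) (1 : GaugeConfig 4 L (Matrix.specialUnitaryGroup (Fin 3) ℂ)) m 1 * P)ᴴ *
      (wilsonDirac (fundamentalRep (Fin 3)) (1 : GaugeConfig 4 L (Matrix.specialUnitaryGroup (Fin 3) ℂ)) m 1 * P) =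
      diagonal fun q : TorusSite 4 L × Fin 3 × Fin 4 =>
        ((((m + ∑ μ : Fin 4, (1 - Real.cos (2 * π * (ZMod.val (q.1 μ) : ℝ) / L))) ^ 2 +
          ∑ μ : Fin 4, Real.sin (2 * π * (ZMod.val (q.1 μ) : ℝ) / L) ^ 2) : ℝ) : ℂ) := by
    rw [hP, wilsonDirac_one_mass_mul_planeP]
    exact symQ_mass_conjTranspose_mul_self m
  have hPu : Pᴴ * P = 1 := by rw [hP]; exact planeP_conjTranspose_mul_self
  rw [exp_neg_smul_conjTranspose_mul_self_apply P _ _ hPu hd σ, Fintype.sum_prod_type]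
  have hs : ∀ (k : TorusSite 4 L) (s : Fin 3 × Fin 4),
      P (x, a, α) (k, s) * Complex.exp (-(σ : ℂ) * ((((m + ∑ μ : Fin 4, (1 - Real.cos (2 * π * (ZMod.val (k μ) : ℝ) / L))) ^ 2 +
          ∑ μ : Fin 4, Real.sin (2 * π * (ZMod.val (k μ) : ℝ) / L) ^ 2) : ℝ) : ℂ)) *
          conj (P (z, b, β) (k, s)) =
        (((L : ℂ) ^ 2)⁻¹ * ((L : ℂ) ^ 2)⁻¹ *
            (Complex.exp (-(σ : ℂ) * ((((m + ∑ μ : Fin 4, (1 - Real.cos (2 * π * (ZMod.val (k μ) : ℝ) / L))) ^ 2 +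
          ∑ μ : Fin 4, Real.sin (2 * π * (ZMod.val (k μ) : ℝ) / L) ^ 2) : ℝ) : ℂ)) *
              (torusChar k x * conj (torusChar k z)))) *
          ((1 : Matrix (Fin 3 × Fin 4) (Fin 3 × Fin 4) ℂ) (a, α) s *
            (1 : Matrix (Fin 3 × Fin 4) (Fin 3 × Fin 4) ℂ) s (b, β)) := by
    intro k s
    rw [hP, Matrix.kroneckerMap_apply, Matrix.kroneckerMap_apply, Matrix.of_apply, Matrix.of_apply,
      map_mul, map_mul, conj_one_apply, map_inv₀, map_pow, map_natCast]
    ring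
  simp_rw [hs]
  rw [← Finset.sum_mul_sum, ← Matrix.mul_apply, Matrix.one_mul, Matrix.one_apply, mul_ite, mul_one,
    mul_zero]

end Summit.QuantumFields.QCD.Cruxes.SmallFieldUltracontractivity.PointCentredAxialParabolic

end
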